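import Summits.Ventures.PercRepro.Night2FatXIndep
import Summits.Ventures.PercRepro.Night2FatXLinesThree

/-!
# night-2: the independent four-subsets of a set carrying a line

The independent-count criterion `basis_pair_fair_of_fat_indep_sum` divides by `I₄(P)`, the number of independent
four-subsets of `P = (T ∖ K) ∖ {w₀, x}`.  A four-subset with three points on a line `S ⊆ P` (`rk S ≤ 2`) is
dependent, so **`card_indep_four_add_le_of_line`**:
`I₄(P) + C(|S|, 3) · (|P| − |S|) + C(|S|, 4) ≤ C(|P|, 4)`.  Above a basis pair with `Y = T ∖ Q ∖ {x}` on a basis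
line `ℓ_ab` (so `S = Y ∪ {a, b}`, `|P| = |Y| + 4`) this is exact: `I₄ = C(|Y| + 2, 2)` (the independent four-subsets
are the two points off the line with two points of it).  Paper `proofs/NIGHT-2-g33.md` §5.
-/

namespace PercRepro.Shadow

open PercRepro.ThmH PercRepro.PerFlat

variable {α : Type*} [DecidableEq α] {M : Matroid α} [M.Finite]

/-- A four-subset with at least three points on a rank-`≤ 2` set is dependent. -/
theorem not_indep_of_three_le_card_inter {S F : Finset α} (h2 : rkN M S ≤ 2) (h3 : 3 ≤ (F ∩ S).card) :
    ¬ M.Indep (↑F : Set α) := by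
  intro hind
  have hsub : M.Indep (↑(F ∩ S) : Set α) := hind.subset (by exact_mod_cast Finset.inter_subset_left)
  have h1 := rkN_eq_card_of_indep hsub
  have h2' : rkN M (F ∩ S) ≤ rkN M S := rkN_mono Finset.inter_subset_right
  omega

open scoped Classical in
/-- **The four-subsets with three points on a line are many**: for `S ⊆ P` there are at least
`C(|S|, 3) · (|P| − |S|) + C(|S|, 4)` four-subsets of `P` meeting `S` in at least three points. -/
theorem choose_add_le_card_filter_three_le_inter {P S : Finset α} (hS : S ⊆ P) :
    S.card.choose 3 * (P.card - S.card) + S.card.choose 4 ≤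
      ((P.powersetCard 4).filter (fun F : Finset α => 3 ≤ (F ∩ S).card)).card := by
  set D := (P.powersetCard 4).filter (fun F : Finset α => 3 ≤ (F ∩ S).card) with hD
  set D₃ := ((S.powersetCard 3) ×ˢ (P \ S)).image (fun q : Finset α × α => insert q.2 q.1) with hD₃
  set D₄ := S.powersetCard 4 with hD₄
  have hD₃sub : D₃ ⊆ D := by
    intro F hF
    rw [hD₃, Finset.mem_image] at hF
    obtain ⟨q, hq, rfl⟩ := hF
    rw [Finset.mem_product, Finset.mem_powersetCard, Finset.mem_sdiff] at hq
    obtain ⟨⟨hAS, hA3⟩, hpP, hpS⟩ := hq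
    have hpA : q.2 ∉ q.1 := fun h => hpS (hAS h)
    rw [hD, Finset.mem_filter, Finset.mem_powersetCard]
    refine ⟨⟨Finset.insert_subset hpP (hAS.trans hS), by rw [Finset.card_insert_of_notMem hpA, hA3]⟩, ?_⟩
    have hsub : q.1 ⊆ insert q.2 q.1 ∩ S := by
      intro e he
      exact Finset.mem_inter.2 ⟨Finset.mem_insert_of_mem he, hAS he⟩
    have := Finset.card_le_card hsub
    omega
  have hD₄sub : D₄ ⊆ D := by
    intro F hF
    rw [hD₄, Finset.mem_powersetCard] at hF
    rw [hD, Finset.mem_filter, Finset.mem_powersetCard]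
    refine ⟨⟨hF.1.trans hS, hF.2⟩, ?_⟩
    rw [Finset.inter_eq_left.2 hF.1, hF.2]
    norm_num
  have hdisj : Disjoint D₃ D₄ := by
    rw [Finset.disjoint_left]
    intro F hF₃ hF₄
    rw [hD₃, Finset.mem_image] at hF₃
    obtain ⟨q, hq, rfl⟩ := hF₃
    rw [Finset.mem_product, Finset.mem_sdiff] at hq
    rw [hD₄, Finset.mem_powersetCard] at hF₄
    exact hq.2.2 (hF₄.1 (Finset.mem_insert_self _ _))
  have hcard₃ : D₃.card = S.card.choose 3 * (P.card - S.card) := by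
    rw [hD₃, Finset.card_image_of_injOn, Finset.card_product, Finset.card_powersetCard,
      Finset.card_sdiff_of_subset hS]
    intro q hq q' hq' heq
    rw [Finset.mem_coe, Finset.mem_product, Finset.mem_powersetCard, Finset.mem_sdiff] at hq hq'
    obtain ⟨⟨hAS, -⟩, -, hpS⟩ := hq
    obtain ⟨⟨hAS', -⟩, -, hpS'⟩ := hq'
    change insert q.2 q.1 = insert q'.2 q'.1 at heq
    have hpp : q.2 = q'.2 := by
      have : q.2 ∈ insert q'.2 q'.1 := by
        rw [← heq]
        exact Finset.mem_insert_self _ _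
      rw [Finset.mem_insert] at this
      rcases this with h | h
      · exact h
      · exact absurd (hAS' h) hpS
    have hAA : q.1 = q'.1 := by
      have h1 : q.2 ∉ q.1 := fun h => hpS (hAS h)
      have h2 : q'.2 ∉ q'.1 := fun h => hpS' (hAS' h)
      have := congrArg (fun F : Finset α => F.erase q.2) heq
      change (insert q.2 q.1).erase q.2 = (insert q'.2 q'.1).erase q.2 at this
      rw [Finset.erase_insert h1, hpp, Finset.erase_insert h2] at this
      exact this
    exact Prod.ext hAA hpp
  have hcard₄ : D₄.card = S.card.choose 4 := by
    rw [hD₄, Finset.card_powersetCard]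
  have := Finset.card_le_card (Finset.union_subset hD₃sub hD₄sub)
  rw [Finset.card_union_of_disjoint hdisj, hcard₃, hcard₄] at this
  exact this

open scoped Classical in
/-- **The independent-four-subset count of a set carrying a line**: `S ⊆ P` of rank `≤ 2` gives
`I₄(P) + C(|S|, 3) · (|P| − |S|) + C(|S|, 4) ≤ C(|P|, 4)`. -/
theorem card_indep_four_add_le_of_line {P S : Finset α} (hS : S ⊆ P) (h2 : rkN M S ≤ 2) :
    ((P.powersetCard 4).filter (fun F : Finset α => M.Indep (↑F : Set α))).card +
      (S.card.choose 3 * (P.card - S.card) + S.card.choose 4) ≤ P.card.choose 4 := by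
  set I := (P.powersetCard 4).filter (fun F : Finset α => M.Indep (↑F : Set α)) with hI
  set D := (P.powersetCard 4).filter (fun F : Finset α => 3 ≤ (F ∩ S).card) with hD
  have hdisj : Disjoint I D := by
    rw [Finset.disjoint_left]
    intro F hFI hFD
    rw [hI, Finset.mem_filter] at hFI
    rw [hD, Finset.mem_filter] at hFD
    exact not_indep_of_three_le_card_inter h2 hFD.2 hFI.2
  have hsub : I ∪ D ⊆ P.powersetCard 4 :=
    Finset.union_subset (Finset.filter_subset _ _) (Finset.filter_subset _ _)
  have h1 := Finset.card_le_card hsub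
  rw [Finset.card_union_of_disjoint hdisj, Finset.card_powersetCard] at h1
  have h2' := choose_add_le_card_filter_three_le_inter hS
  rw [← hD] at h2'
  omega


variable {G : Finset α}

/-- `|(T ∖ K) ∖ {w₀, x}| = |T ∖ Q| + 3` at a target of a basis pair containing the two off-points. -/
theorem card_sdiff_off_eq_level_add_three (hG : G ∈ flatsQ M (5 + 1)) (hd : (gr M \ G).card = 2)
    (hk : kColoops M G = 1) {B₀ : Finset α} (hB₀ : B₀ ∈ thinMembers M 5 G) {w₀ x : α}
    (hD : G \ clF M B₀ = {w₀, x}) (hne : w₀ ≠ x) {B : Finset α} (hB : B ∈ thinMembers M 5 G)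
    (hnP : ¬ bigP M G B) {z : α} (hz : z ∈ G \ clF M B) {T : Finset α} (hT : T ∈ tgtSets M 5 G B z)
    (hw₀T : w₀ ∈ T) (hxT : x ∈ T) :
    ((T \ coloops M G) \ {w₀, x}).card + 2 = (T \ insert z B).card + 5 := by
  have hd' : (gr M \ G).card ≤ 5 := by omega
  have hGg : G ⊆ gr M := (mem_flatsQ.1 hG).1
  have hoffK : ∀ u, u ∈ ({w₀, x} : Finset α) → u ∉ coloops M G := by
    intro u hu huK
    have h1 : u ∈ clF M B₀ := subset_clF_of_subset_gr ((subset_G_of_mem_thinMembers hB₀).trans hGg)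
      (coloops_subset_of_mem_thinMembers hG hd' hB₀ huK)
    have h2 : u ∈ G \ clF M B₀ := by
      rw [hD]
      exact hu
    exact (Finset.mem_sdiff.1 h2).2 h1
  have hsub : ({w₀, x} : Finset α) ⊆ T \ coloops M G := by
    intro u hu
    refine Finset.mem_sdiff.2 ⟨?_, hoffK u hu⟩
    rw [Finset.mem_insert, Finset.mem_singleton] at hu
    rcases hu with rfl | rfl
    · exact hw₀T
    · exact hxT
  have h1 := Finset.card_sdiff_add_card_eq_card hsub
  rw [Finset.card_pair hne] at h1
  rw [card_sdiff_coloops_eq_level_add_five hG hd hk hB hnP hz hT] at h1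
  omega

open scoped Classical in
/-- **The independent count of a target carrying a line**: at a target `T = Q ∪ {x} ∪ Y` of a basis pair with a
rank-`2` set `R ⊆ (T ∖ K) ∖ {w₀, x}` (`|R| ≥ 3`), the independent four-subsets number at most
`C(|Y| + 4, 4) − C(|R|, 3) · (|Y| + 4 − |R|) − C(|R|, 4)`, `|Y| + 1 = |T ∖ Q|`. -/
theorem card_indep_four_le_of_line_target (hG : G ∈ flatsQ M (5 + 1)) (hd : (gr M \ G).card = 2)
    (hk : kColoops M G = 1) {B₀ : Finset α} (hB₀ : B₀ ∈ thinMembers M 5 G) {w₀ x : α}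
    (hD : G \ clF M B₀ = {w₀, x}) (hne : w₀ ≠ x) {B : Finset α} (hB : B ∈ thinMembers M 5 G)
    (hnP : ¬ bigP M G B) {z : α} (hz : z ∈ G \ clF M B) {T : Finset α} (hT : T ∈ tgtSets M 5 G B z)
    (hw₀T : w₀ ∈ T) (hxT : x ∈ T) {R : Finset α} (hR : R ⊆ (T \ coloops M G) \ {w₀, x}) (hR2 : rkN M R = 2) :
    ((((T \ coloops M G) \ {w₀, x}).powersetCard 4).filter (fun F : Finset α => M.Indep (↑F : Set α))).card +
      (R.card.choose 3 * ((T \ insert z B).card + 3 - R.card) + R.card.choose 4) ≤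
      ((T \ insert z B).card + 3).choose 4 := by
  have hP := card_sdiff_off_eq_level_add_three hG hd hk hB₀ hD hne hB hnP hz hT hw₀T hxT
  have h := card_indep_four_add_le_of_line (M := M) hR (by omega)
  have hP' : ((T \ coloops M G) \ {w₀, x}).card = (T \ insert z B).card + 3 := by omega
  rw [hP'] at h
  exact h

end PercRepro.Shadow
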